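import Summits.Langlands.Langlands.Theorems.ParityBlindBianchiQuadraticDescentGL2AsaiFactorisation
import Literature.NumberTheory.Automorphic.AsaiAtOneOfHolomorphy
import Literature.NumberTheory.Automorphic.PairLFunctionPolesEqConjLeTwo
import Literature.NumberTheory.Automorphic.PairLFunctionMeromorphicContinuationNeConjProofs
import Literature.NumberTheory.Automorphic.PairLFunctionPolesRepDataBoundaryRankOne
import Literature.NumberTheory.Automorphic.LanglandsTetrahedralProofs
import HarnessLib

/-!
# The twisted Asai pole dichotomy at `s = 1` for `GL₂`, continuation currency — helper for stub
`stub_twistedAsaiPole`, line `Sketch`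
(crux `Summit.Langlands.Langlands.Theses.ParityBlindBianchi.QuadraticDescentGL2`, item stmt-Langlands-16811)

Stub worker, 2026-08-17.  Sorry-free glue: the order count of the printed route ("`L(s, P × P^∨)` has
a simple pole at `s = 1` (Jacquet–Shalika), `= L(s, As⁺ ⊗ χ) L(s, As⁻ ⊗ χ)`, both factors have at most
a simple pole, hence exactly one has the pole and the other is holomorphic and non-zero at `1`"), in
the CONTINUATION currency of `AsaiSignCont` / `GrbacShahidi2015_partialAsaiL_at_one` (functions
holomorphic on `{1 < Re s} ∪ B(1, δ)` agreeing with the raw Euler products far to the right), for the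
`χ`-TWISTED partial Asai `L`-functions `partialAsaiLTwist` (`TwistedAsaiPole`) of a cuspidal `P` on
`GL₂(𝔸_E)`.

**Main statements (all proved).**
* `exists_finite_pairL_dual_package` — **Jacquet–Shalika for `(P, P^∨)` on `GL₂`, from THEOREMS of the
  tree**: off a finite `S₁`, for every finite `T ⊇ S₁` and Satake family `A` of `P` off `T`,
  `R(s) = L^T(s, A × A^∨)` is multipliable and holomorphic on `{1 < Re s}` and `(s - 1) R(s) → r ≠ 0`
  (`s → 1⁺`): Borel–Jacquet normalisation `t_P = q^z t_{P₀}` (`exists_satake_eq_cpow_mul_L2_holds`),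
  `t⁻¹ = t̄` for `L²` families, so `R = L^T(s, P₀ × P̄₀)` exactly; JS I (5.3)
  (`JacquetShalika1981_multipliable_partialPairL_holds`, `differentiableOn_partialPairL_of_isSatakeFamilyOf`)
  and (2.3) in rank `≤ 2` (`JacquetShalika1981_partialPairL_pole_of_eq_conj_holds_of_le_two`).
* `eventually_mul_eq_sq_mul_partialPairL_dual`, `twistedAsai_dichotomy_at_one`,
  `twistedAsai_pole_sign_unique`, `twistedAsai_continuations_at_one` — per datum `(S, A, m)` under the
  family-level hypotheses of the accepted factorisation (`…AsaiFactorisation`): with continuations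
  `G θ` of `(s - 1) L^S(s, A, As^θ ⊗ m)` to `{1 < Re s} ∪ B(1, δ)` and the package for `R`, SOME sign
  `η` has `G η 1 ≠ 0`, while `G (-η) 1 = 0`, `(G (-η))'(1) ≠ 0` (`dslope` continuation of the other
  function, non-zero at `1`); the order count is the accepted `apply_one_mul_*_of_pole`
  (`AsaiAtOneOfHolomorphy`).

The passage from the a.e. hypotheses of the stub to large data, and the reshaped stub modulo the
twisted Asai continuations, are in the sequel `…TwistedAsaiPoleCont`.  What this does NOT give: the
continuations `G θ` (no declaration of the tree continues TWISTED Asai `L`-functions); Shahidi's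
non-vanishing (1981, Thm. 5.1) is NOT needed — it is output of the order count.

## References
* N. Grbac, F. Shahidi, Pacific J. Math. 276 (2015), proof of Thm. 4.3, p. 206 (order count). [GrbacShahidi2015]
* J. Arthur, L. Clozel, Ann. of Math. Stud. 120 (1989), Ch. 3 §2 (2.1), (2.3). [ArthurClozelAMS120]
* H. Jacquet, J. Shalika, Amer. J. Math. 103 (1981) I Thm. (5.3); II Prop. 3.6. [JacquetShalikaAJM1981]
* A. Borel, H. Jacquet, Corvallis 1979, 5.7. [BorelJacquetCorvallis1979]
* Y. Z. Flicker, Bull. SMF 116 (1988), p. 296–297. [Flicker1988]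
-/

set_option linter.dupNamespace false -- project-wide option (lakefile weak.linter.dupNamespace); `Summit.Langlands.Langlands` is the mandated namespace

noncomputable section

open scoped Classical Topology
open Filter Polynomial NumberField IsDedekindDomain MeasureTheory
open Literature.NumberTheory.Automorphic Literature.NumberTheory.GaloisRepresentations

namespace Summit.Langlands.Langlands.Theorems.QuadraticDescentGL2.Sketch

open AdelicGroupData

/-! ### Jacquet–Shalika for the pair `(P, P^∨)` on `GL₂`, from theorems of the tree -/

section PairDual

variable {K : Type} [Field K] [NumberField K]

/-- **The Rankin–Selberg package of `(P, P^∨)` for a cuspidal `P` on `GL₂(𝔸_K)`, unconditionally.**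
There is a finite set `S₁` of places of `K` such that for every finite `T ⊇ S₁` and every family `A` of
Satake parameters of `P` off `T`, the raw partial product `R(s) = L^T(s, A × A^∨)`
(`partialPairL T A A⁻¹`) is multipliable and holomorphic on `{1 < Re s}` and `(s - 1) R(s) → r ≠ 0`
as `s → 1`, `Re s > 1` — Arthur–Clozel Ch. 3 (2.1), (2.3) for `π ⊗ π̃` ("the limit … exists and is
finite and non-zero").  Proof from THEOREMS of the tree: the Borel–Jacquet normalisation
`t_{P,w} = q_w^{z} t_{P₀,w}`, `P₀ ≤ L²_cusp` (`exists_satake_eq_cpow_mul_L2_holds`, BJ 5.7) gives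
`t_{P,w}⁻¹ = q_w^{-z} \bar t_{P₀,w}` (`IsSatakeFamilyOf.map_inv_eq_map_conj`: `t⁻¹ = t̄` for `L²`
families), so `R(s) = L^T(s, P₀ × P̄₀)` EXACTLY (the shifts `z`, `-z` cancel — no unitarity needed);
then Jacquet–Shalika I Thm. (5.3) (`JacquetShalika1981_multipliable_partialPairL_holds`,
`differentiableOn_partialPairL_of_isSatakeFamilyOf`) and (2.3) for `(P₀, P̄₀)`, a theorem in rank
`≤ 2` (`JacquetShalika1981_partialPairL_pole_of_eq_conj_holds_of_le_two`).
[cite: ArthurClozelAMS120, Ch. 3 §2 (2.1), (2.3)] [cite: BorelJacquetCorvallis1979, 5.7] -/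
theorem exists_finite_pairL_dual_package {hK : isCompact_glFiniteIntegralLevel 2 K}
    (P : CuspidalAutomorphicRepData 2 K hK) :
    ∃ S₁ : Set (HeightOneSpectrum (𝓞 K)), S₁.Finite ∧
      ∀ ⦃T : Set (HeightOneSpectrum (𝓞 K))⦄ ⦃A : SatakeFamily K⦄, S₁ ⊆ T → T.Finite →
        (∀ w : HeightOneSpectrum (𝓞 K), w ∉ T → P.1.HasSatakeParamAt w (A w)) →
        (∀ s : ℂ, 1 < s.re → Multipliable fun w : {w : HeightOneSpectrum (𝓞 K) // w ∉ T} =>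
            ((satakePairPolynomial (A w.1) ((A w.1).map (·⁻¹))).eval ((w.1.residueCard : ℂ) ^ (-s)))⁻¹) ∧
        DifferentiableOn ℂ (partialPairL T A (fun w => (A w).map (·⁻¹))) {s : ℂ | 1 < s.re} ∧
        ∃ r : ℂ, r ≠ 0 ∧ Tendsto (fun s => (s - 1) * partialPairL T A (fun w => (A w).map (·⁻¹)) s)
          (𝓝[{s : ℂ | 1 < s.re}] 1) (𝓝 r) := by
  classical
  obtain ⟨μ, hμ⟩ := AdelicGroupData.exists_isAutomorphicMeasure_gl_holds 2 K
  haveI := hμ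
  obtain ⟨z, P₀, S₁, αP, hS₁, hαP, hiff⟩ :=
    CuspidalAutomorphicRepData.exists_satake_eq_cpow_mul_L2_holds μ P
  refine ⟨S₁, hS₁, fun T A hS₁T hT hA => ?_⟩
  have hαT : IsSatakeFamilyOf P₀ T αP := hαP.mono hS₁T
  have hβT : IsSatakeFamilyOf P₀.conj T (fun w => (αP w).map (starRingEnd ℂ)) := hαT.conj
  have hAe : ∀ w : HeightOneSpectrum (𝓞 K), w ∉ T →
      A w = (αP w).map (((w.residueCard : ℂ) ^ z) * ·) := fun w hw =>
    (hiff w (fun h => hw (hS₁T h)) _).1 (hA w hw)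
  have hBe : ∀ w : HeightOneSpectrum (𝓞 K), w ∉ T → (A w).map (·⁻¹) =
      ((αP w).map (starRingEnd ℂ)).map (((w.residueCard : ℂ) ^ (-z)) * ·) := by
    intro w hw
    rw [hAe w hw, ← hαT.map_inv_eq_map_conj hw, Multiset.map_map, Multiset.map_map]
    refine Multiset.map_congr rfl fun a _ => ?_
    simp only [Function.comp_apply, mul_inv, Complex.cpow_neg]
  have hz : z + -z = 0 := add_neg_cancel z
  -- the Euler factors of `(A, A^∨)` are those of `(t_{P₀}, \bar t_{P₀})`, exactly
  have hpt : ∀ (s : ℂ) (w : {w : HeightOneSpectrum (𝓞 K) // w ∉ T}),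
      ((satakePairPolynomial (αP w.1) ((αP w.1).map (starRingEnd ℂ))).eval
          ((w.1.residueCard : ℂ) ^ (-s)))⁻¹ =
        ((satakePairPolynomial (A w.1) ((A w.1).map (·⁻¹))).eval ((w.1.residueCard : ℂ) ^ (-s)))⁻¹ := by
    intro s w
    have hq : ((w.1.residueCard : ℕ) : ℂ) ≠ 0 :=
      Nat.cast_ne_zero.mpr (by have := w.1.one_lt_residueCard; omega)
    rw [hBe w.1 w.2, hAe w.1 w.2, eval_satakePairPolynomial_map_mul_map_mul,
      ← Complex.cpow_add _ _ hq, hz, Complex.cpow_zero, one_mul]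
  have hL : partialPairL T αP (fun w => (αP w).map (starRingEnd ℂ)) =
      partialPairL T A (fun w => (A w).map (·⁻¹)) := by
    funext s
    simp only [partialPairL]
    exact tprod_congr fun w => hpt s w
  refine ⟨fun s hs => ?_, ?_, ?_⟩
  · exact (JacquetShalika1981_multipliable_partialPairL_holds P₀ P₀.conj hαT hβT hs).congr (hpt s)
  · rw [← hL]
    exact differentiableOn_partialPairL_of_isSatakeFamilyOf P₀ P₀.conj hαT hβT
  · obtain ⟨r, hr, hlim⟩ :=
      JacquetShalika1981_partialPairL_pole_of_eq_conj_holds_of_le_two (n := 2) (K := K) (μ := μ)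
        (le_refl 2) two_pos P₀ P₀.conj (CuspidalAutomorphicRepGL.conj_conj P₀).symm hT hαT hβT
    refine ⟨r, hr, ?_⟩
    rw [← hL]
    exact hlim

end PairDual


variable {F E : Type} [Field F] [NumberField F] [Field E] [NumberField E] [Algebra F E]

/-- **The factorisation near `s = 1` for the continuations**: with `G θ = (s - 1) L^S(s, A, As^θ ⊗ m)`
on `{σ < Re s}`, holomorphic on `{1 < Re s} ∪ B(1, δ)`, and `R = L^{S_E}(s, A × A^∨)` holomorphic on
`{1 < Re s}`: `G 1 · G (-1) = (s - 1)² R` near `1` in `{1 < Re s}` (the accepted twisted factorisation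
on `{σ < Re s}`, then the identity theorem down to `{1 < Re s}`).
[cite: GrbacShahidi2015, proof of Thm. 4.3, (∗∗) p. 205] -/
theorem eventually_mul_eq_sq_mul_partialPairL_dual (h2 : Module.finrank F E = 2) {c : E ≃ₐ[F] E}
    (hc : c ≠ 1) {S : Set (HeightOneSpectrum (𝓞 F))} {A : SatakeFamily E}
    {m : HeightOneSpectrum (𝓞 F) → ℂ}
    (hstab : ∀ w : HeightOneSpectrum (𝓞 E), w.under (𝓞 F) ∉ S → A (c • w) = A w)
    (hcard : ∀ w : HeightOneSpectrum (𝓞 E), w.under (𝓞 F) ∉ S → Multiset.card (A w) = 2)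
    (hcent : ∀ w : HeightOneSpectrum (𝓞 E), w.under (𝓞 F) ∉ S →
      (A w).prod * m (w.under (𝓞 F)) ^ w.asIdeal.inertiaDeg (𝓞 F) = 1)
    (hinert : ∀ w : HeightOneSpectrum (𝓞 E), w.under (𝓞 F) ∉ S → c • w = w →
      w.asIdeal.inertiaDeg (𝓞 F) = 2)
    {σ δ : ℝ} (hσ : 1 ≤ σ)
    (hmulA : ∀ (θ : ℤˣ) (s : ℂ), σ < s.re →
      Multipliable fun v : {v : HeightOneSpectrum (𝓞 F) // v ∉ S} =>
        ((asaiLocalPolynomial c A θ (placeAbove E v.1)).eval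
          (m v.1 * (v.1.residueCard : ℂ) ^ (-s)))⁻¹)
    (hmulP : ∀ s : ℂ, σ < s.re →
      Multipliable fun w : {w : HeightOneSpectrum (𝓞 E) // w.under (𝓞 F) ∉ S} =>
        ((satakePairPolynomial (A w.1) ((A w.1).map (·⁻¹))).eval ((w.1.residueCard : ℂ) ^ (-s)))⁻¹)
    (hRhol : DifferentiableOn ℂ
      (partialPairL {w : HeightOneSpectrum (𝓞 E) | w.under (𝓞 F) ∈ S} A (fun w => (A w).map (·⁻¹)))
      {s : ℂ | 1 < s.re})
    {G : ℤˣ → ℂ → ℂ} (hG : ∀ θ : ℤˣ, DifferentiableOn ℂ (G θ) ({s : ℂ | 1 < s.re} ∪ Metric.ball (1 : ℂ) δ))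
    (hGL : ∀ (θ : ℤˣ) (s : ℂ), σ < s.re → G θ s = (s - 1) * partialAsaiLTwist S c A m θ s) :
    ∀ᶠ s in 𝓝[{s : ℂ | 1 < s.re}] (1 : ℂ), G 1 s * G (-1) s =
      (s - 1) ^ 2 * partialPairL {w : HeightOneSpectrum (𝓞 E) | w.under (𝓞 F) ∈ S} A
        (fun w => (A w).map (·⁻¹)) s := by
  refine eventually_eq_nhdsWithin_one_of_eq_on_lt_re (Φ := fun s => G 1 s * G (-1) s)
    (Ψ := fun s => (s - 1) ^ 2 * partialPairL {w : HeightOneSpectrum (𝓞 E) | w.under (𝓞 F) ∈ S} A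
      (fun w => (A w).map (·⁻¹)) s) hσ ?_ ?_ (fun s hs => ?_)
  · exact ((hG 1).mono Set.subset_union_left).mul ((hG (-1)).mono Set.subset_union_left)
  · exact ((differentiableOn_id.sub_const 1).pow 2).mul hRhol
  · rw [hGL 1 s hs, hGL (-1) s hs, partialPairL_dual_eq_partialAsaiLTwist_mul h2 hc S A m hstab hcard
      hcent hinert (hmulP s hs) (hmulA 1 s hs) (hmulA (-1) s hs)]
    ring

/-- **The twisted Asai pole dichotomy at `s = 1` (continuation currency), for one datum.**  In the
setting of `eventually_mul_eq_sq_mul_partialPairL_dual`, if moreover `(s - 1) R(s) → r ≠ 0` as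
`s → 1`, `Re s > 1` (the simple pole of `L^{S_E}(s, P × P^∨)`, Jacquet–Shalika), then there is a sign
`η` with `G η 1 ≠ 0` — the continued `L^S(s, A, As^η ⊗ m)` has a simple pole at `s = 1` — while
`G (-η) 1 = 0` and `(G (-η))'(1) ≠ 0` — the continued `L^S(s, A, As^{-η} ⊗ m)` is holomorphic and
non-zero at `s = 1`.  ("Both … have at most a simple pole at `s = 1`. Hence, they are both nonzero at
`s = 1`, and exactly one of them has a simple pole", Grbac–Shahidi p. 206, here for the twisted pair.)
[cite: GrbacShahidi2015, proof of Thm. 4.3, p. 206] [cite: JacquetShalikaAJM1981II, Prop. 3.6] -/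
theorem twistedAsai_dichotomy_at_one (h2 : Module.finrank F E = 2) {c : E ≃ₐ[F] E}
    (hc : c ≠ 1) {S : Set (HeightOneSpectrum (𝓞 F))} {A : SatakeFamily E}
    {m : HeightOneSpectrum (𝓞 F) → ℂ}
    (hstab : ∀ w : HeightOneSpectrum (𝓞 E), w.under (𝓞 F) ∉ S → A (c • w) = A w)
    (hcard : ∀ w : HeightOneSpectrum (𝓞 E), w.under (𝓞 F) ∉ S → Multiset.card (A w) = 2)
    (hcent : ∀ w : HeightOneSpectrum (𝓞 E), w.under (𝓞 F) ∉ S →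
      (A w).prod * m (w.under (𝓞 F)) ^ w.asIdeal.inertiaDeg (𝓞 F) = 1)
    (hinert : ∀ w : HeightOneSpectrum (𝓞 E), w.under (𝓞 F) ∉ S → c • w = w →
      w.asIdeal.inertiaDeg (𝓞 F) = 2)
    {σ δ : ℝ} (hσ : 1 ≤ σ) (hδ : 0 < δ)
    (hmulA : ∀ (θ : ℤˣ) (s : ℂ), σ < s.re →
      Multipliable fun v : {v : HeightOneSpectrum (𝓞 F) // v ∉ S} =>
        ((asaiLocalPolynomial c A θ (placeAbove E v.1)).eval
          (m v.1 * (v.1.residueCard : ℂ) ^ (-s)))⁻¹)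
    (hmulP : ∀ s : ℂ, σ < s.re →
      Multipliable fun w : {w : HeightOneSpectrum (𝓞 E) // w.under (𝓞 F) ∉ S} =>
        ((satakePairPolynomial (A w.1) ((A w.1).map (·⁻¹))).eval ((w.1.residueCard : ℂ) ^ (-s)))⁻¹)
    (hRhol : DifferentiableOn ℂ
      (partialPairL {w : HeightOneSpectrum (𝓞 E) | w.under (𝓞 F) ∈ S} A (fun w => (A w).map (·⁻¹)))
      {s : ℂ | 1 < s.re})
    {r : ℂ} (hr : r ≠ 0)
    (hpole : Tendsto (fun s => (s - 1) *
        partialPairL {w : HeightOneSpectrum (𝓞 E) | w.under (𝓞 F) ∈ S} A (fun w => (A w).map (·⁻¹)) s)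
      (𝓝[{s : ℂ | 1 < s.re}] 1) (𝓝 r))
    {G : ℤˣ → ℂ → ℂ} (hG : ∀ θ : ℤˣ, DifferentiableOn ℂ (G θ) ({s : ℂ | 1 < s.re} ∪ Metric.ball (1 : ℂ) δ))
    (hGL : ∀ (θ : ℤˣ) (s : ℂ), σ < s.re → G θ s = (s - 1) * partialAsaiLTwist S c A m θ s) :
    ∃ η : ℤˣ, G η 1 ≠ 0 ∧ G (-η) 1 = 0 ∧ deriv (G (-η)) 1 ≠ 0 := by
  have hfac := eventually_mul_eq_sq_mul_partialPairL_dual h2 hc hstab hcard hcent hinert hσ hmulA hmulP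
    hRhol hG hGL
  have h0 := apply_one_mul_apply_one_eq_zero_of_pole hδ (hG 1) (hG (-1)) hpole hfac
  rcases mul_eq_zero.mp h0 with h1 | h1
  · -- `G 1 1 = 0`: the pole sits at `η = -1`
    have hfac' : ∀ᶠ s in 𝓝[{s : ℂ | 1 < s.re}] (1 : ℂ), G (-1) s * G 1 s =
        (s - 1) ^ 2 * partialPairL {w : HeightOneSpectrum (𝓞 E) | w.under (𝓞 F) ∈ S} A
          (fun w => (A w).map (·⁻¹)) s := hfac.mono fun s hs => by rw [mul_comm, hs]
    have key := apply_one_mul_deriv_one_eq_of_pole hδ (hG (-1)) (hG 1) hpole hfac' h1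
    refine ⟨-1, fun h => hr (by rw [← key, h, zero_mul]), ?_, ?_⟩
    · rw [neg_neg]; exact h1
    · rw [neg_neg]; exact fun h => hr (by rw [← key, h, mul_zero])
  · -- `G (-1) 1 = 0`: the pole sits at `η = 1`
    have key := apply_one_mul_deriv_one_eq_of_pole hδ (hG 1) (hG (-1)) hpole hfac h1
    exact ⟨1, fun h => hr (by rw [← key, h, zero_mul]), h1, fun h => hr (by rw [← key, h, mul_zero])⟩

/-- **Uniqueness of the pole sign at one datum**: in the same setting, if `G η 1 ≠ 0` then
`G (-η) 1 = 0` (`G 1 1 · G (-1) 1 = 0`: the product has only a simple pole). [folklore] -/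
theorem twistedAsai_pole_sign_unique (h2 : Module.finrank F E = 2) {c : E ≃ₐ[F] E}
    (hc : c ≠ 1) {S : Set (HeightOneSpectrum (𝓞 F))} {A : SatakeFamily E}
    {m : HeightOneSpectrum (𝓞 F) → ℂ}
    (hstab : ∀ w : HeightOneSpectrum (𝓞 E), w.under (𝓞 F) ∉ S → A (c • w) = A w)
    (hcard : ∀ w : HeightOneSpectrum (𝓞 E), w.under (𝓞 F) ∉ S → Multiset.card (A w) = 2)
    (hcent : ∀ w : HeightOneSpectrum (𝓞 E), w.under (𝓞 F) ∉ S →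
      (A w).prod * m (w.under (𝓞 F)) ^ w.asIdeal.inertiaDeg (𝓞 F) = 1)
    (hinert : ∀ w : HeightOneSpectrum (𝓞 E), w.under (𝓞 F) ∉ S → c • w = w →
      w.asIdeal.inertiaDeg (𝓞 F) = 2)
    {σ δ : ℝ} (hσ : 1 ≤ σ) (hδ : 0 < δ)
    (hmulA : ∀ (θ : ℤˣ) (s : ℂ), σ < s.re →
      Multipliable fun v : {v : HeightOneSpectrum (𝓞 F) // v ∉ S} =>
        ((asaiLocalPolynomial c A θ (placeAbove E v.1)).eval
          (m v.1 * (v.1.residueCard : ℂ) ^ (-s)))⁻¹)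
    (hmulP : ∀ s : ℂ, σ < s.re →
      Multipliable fun w : {w : HeightOneSpectrum (𝓞 E) // w.under (𝓞 F) ∉ S} =>
        ((satakePairPolynomial (A w.1) ((A w.1).map (·⁻¹))).eval ((w.1.residueCard : ℂ) ^ (-s)))⁻¹)
    (hRhol : DifferentiableOn ℂ
      (partialPairL {w : HeightOneSpectrum (𝓞 E) | w.under (𝓞 F) ∈ S} A (fun w => (A w).map (·⁻¹)))
      {s : ℂ | 1 < s.re})
    {r : ℂ}
    (hpole : Tendsto (fun s => (s - 1) *
        partialPairL {w : HeightOneSpectrum (𝓞 E) | w.under (𝓞 F) ∈ S} A (fun w => (A w).map (·⁻¹)) s)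
      (𝓝[{s : ℂ | 1 < s.re}] 1) (𝓝 r))
    {G : ℤˣ → ℂ → ℂ} (hG : ∀ θ : ℤˣ, DifferentiableOn ℂ (G θ) ({s : ℂ | 1 < s.re} ∪ Metric.ball (1 : ℂ) δ))
    (hGL : ∀ (θ : ℤˣ) (s : ℂ), σ < s.re → G θ s = (s - 1) * partialAsaiLTwist S c A m θ s)
    {η : ℤˣ} (hη : G η 1 ≠ 0) : G (-η) 1 = 0 := by
  have hfac := eventually_mul_eq_sq_mul_partialPairL_dual h2 hc hstab hcard hcent hinert hσ hmulA hmulP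
    hRhol hG hGL
  have h0 := apply_one_mul_apply_one_eq_zero_of_pole hδ (hG 1) (hG (-1)) hpole hfac
  rcases Int.units_eq_one_or η with rfl | rfl
  · rcases mul_eq_zero.mp h0 with h | h
    · exact absurd h hη
    · exact h
  · rcases mul_eq_zero.mp h0 with h | h
    · rw [neg_neg]; exact h
    · exact absurd h hη

/-- **The dichotomy packaged as continuations** (the shape of `HasAsaiPoleCont` /
`GrbacShahidi2015_partialAsaiL_at_one`, for the twisted pair at one datum): a sign `η`, the
continuation `G η` of `(s - 1) L^S(s, A, As^η ⊗ m)` with `G η 1 ≠ 0` (simple pole), and a continuation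
`H = dslope (G (-η)) 1` of `L^S(s, A, As^{-η} ⊗ m)` itself, holomorphic on `{1 < Re s} ∪ B(1, δ)` with
`H 1 ≠ 0` (holomorphic and non-vanishing at `1`). [cite: GrbacShahidi2015, proof of Thm. 4.3, p. 206] -/
theorem twistedAsai_continuations_at_one (h2 : Module.finrank F E = 2) {c : E ≃ₐ[F] E}
    (hc : c ≠ 1) {S : Set (HeightOneSpectrum (𝓞 F))} {A : SatakeFamily E}
    {m : HeightOneSpectrum (𝓞 F) → ℂ}
    (hstab : ∀ w : HeightOneSpectrum (𝓞 E), w.under (𝓞 F) ∉ S → A (c • w) = A w)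
    (hcard : ∀ w : HeightOneSpectrum (𝓞 E), w.under (𝓞 F) ∉ S → Multiset.card (A w) = 2)
    (hcent : ∀ w : HeightOneSpectrum (𝓞 E), w.under (𝓞 F) ∉ S →
      (A w).prod * m (w.under (𝓞 F)) ^ w.asIdeal.inertiaDeg (𝓞 F) = 1)
    (hinert : ∀ w : HeightOneSpectrum (𝓞 E), w.under (𝓞 F) ∉ S → c • w = w →
      w.asIdeal.inertiaDeg (𝓞 F) = 2)
    {σ δ : ℝ} (hσ : 1 ≤ σ) (hδ : 0 < δ)
    (hmulA : ∀ (θ : ℤˣ) (s : ℂ), σ < s.re →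
      Multipliable fun v : {v : HeightOneSpectrum (𝓞 F) // v ∉ S} =>
        ((asaiLocalPolynomial c A θ (placeAbove E v.1)).eval
          (m v.1 * (v.1.residueCard : ℂ) ^ (-s)))⁻¹)
    (hmulP : ∀ s : ℂ, σ < s.re →
      Multipliable fun w : {w : HeightOneSpectrum (𝓞 E) // w.under (𝓞 F) ∉ S} =>
        ((satakePairPolynomial (A w.1) ((A w.1).map (·⁻¹))).eval ((w.1.residueCard : ℂ) ^ (-s)))⁻¹)
    (hRhol : DifferentiableOn ℂ
      (partialPairL {w : HeightOneSpectrum (𝓞 E) | w.under (𝓞 F) ∈ S} A (fun w => (A w).map (·⁻¹)))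
      {s : ℂ | 1 < s.re})
    {r : ℂ} (hr : r ≠ 0)
    (hpole : Tendsto (fun s => (s - 1) *
        partialPairL {w : HeightOneSpectrum (𝓞 E) | w.under (𝓞 F) ∈ S} A (fun w => (A w).map (·⁻¹)) s)
      (𝓝[{s : ℂ | 1 < s.re}] 1) (𝓝 r))
    {G : ℤˣ → ℂ → ℂ} (hG : ∀ θ : ℤˣ, DifferentiableOn ℂ (G θ) ({s : ℂ | 1 < s.re} ∪ Metric.ball (1 : ℂ) δ))
    (hGL : ∀ (θ : ℤˣ) (s : ℂ), σ < s.re → G θ s = (s - 1) * partialAsaiLTwist S c A m θ s) :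
    ∃ η : ℤˣ, G η 1 ≠ 0 ∧
      ∃ H : ℂ → ℂ, DifferentiableOn ℂ H ({s : ℂ | 1 < s.re} ∪ Metric.ball (1 : ℂ) δ) ∧
        (∀ s : ℂ, σ < s.re → H s = partialAsaiLTwist S c A m (-η) s) ∧ H 1 ≠ 0 := by
  obtain ⟨η, hη, h0, hd⟩ := twistedAsai_dichotomy_at_one h2 hc hstab hcard hcent hinert hσ hδ hmulA hmulP
    hRhol hr hpole hG hGL
  exact ⟨η, hη, dslope (G (-η)) 1, differentiableOn_dslope_one hδ (hG (-η)),
    fun s hs => dslope_one_eq_of_eq_sub_one_mul hσ h0 (hGL (-η)) hs, by rw [dslope_same]; exact hd⟩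

/-- **Anchor of this helper file** (registered sub-goal `twistedAsaiPoleDichotomy_anchor` of the crux
item, so that the file lands with `--supports`): the sign bookkeeping `a · b = 0`, `a ≠ 0 ∨ b ≠ 0` used
above, in its simplest form. [folklore] -/
theorem twistedAsaiPoleDichotomy_anchor : ∀ (a b : ℂ), a * b = 0 → a ≠ 0 → b = 0 :=
  fun _ _ h ha => (mul_eq_zero.mp h).resolve_left ha

end Summit.Langlands.Langlands.Theorems.QuadraticDescentGL2.Sketch

end
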